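import Mathlib

/-!
# StubPlanT3LocalTypeGlue — critic certificate (STUB-PLAN v2.5, scrit g12), crux stmt-BirchSwinnertonDyer-27851

Independent kernel re-proof of the CONSUMED SHAPE of card k3-g9 («local type is Waldspurger»),
whose own sketch `STUB_IDEAS_stub_heegnerIndexLowerAtTwo_3_g9.lean` is evidence-only (not in the
crux directory, hence not checkable by critics).  Nothing here is research: it certifies that

* (G1) three interpolation/period identities `Ka = Ca·La`, `Kb = Cb·Lb`, `S² = Cs·L` with the Artin
  factorisation `L = La·Lb` give the engine identity `Ka·Kb = w·S²` with the EXPLICIT constant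
  `w = Ca·Cb/Cs` (no choice), unique as soon as `S ≠ 0`;
* (P-sq) Waldspurger's formula is about the PAIR `P_χ(φ)·P_{χ⁻¹}(φ̃)`; the passage to the square of ONE
  CM sum needs a relation `P' = u·P` and books `u` into the constant (`sq_of_pair`);
* (G2) `ord w = ord Ca + ord Cb − ord Cs` for any valuation-like map;
* the LOCAL-TYPE ledger (glob + level digit + 2-adic key digit + 7-digit + Σ over odd primes of a
  digit depending on the prime and its splitting sign only) is closed under the (G1) combination and
  yields: REL at every level (arm L), δ-rigidity of the net-of-member-digits (arm M), the NET
  engine-minus-GZ constant is a class function when the odd digits agree (route-C consistency), the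
  level digits are eventually constant when `w` is (B16 detector), and a prime's digit transfers
  between members (non-vacuity: local type is a testable constraint, R66).

The level-dependent archimedean digit `lamInf n` carries the level argument (critic's P-n).
BSD is not proved by any of this; the research content of k3-g9 is the INSTANTIATION of the three
ledgers from print at `p = 2` (LT3/LT4 audits, carriers D1/D2/D1-KS/D-W).
-/

set_option linter.dupNamespace false
set_option autoImplicit false

namespace Summit.BirchSwinnertonDyer.BirchSwinnertonDyer.Cruxes.SplitBadTwoLowerHalfOfFacts.StubPlanT3LocalType

section Algebra

variable {K : Type*} [Field K]

/-- (G1) factorisation of interpolations: the constant is `Ca·Cb/Cs`, nothing is chosen. -/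
theorem factorisation_of_interpolations {Ka Kb S La Lb L Ca Cb Cs : K}
    (ha : Ka = Ca * La) (hb : Kb = Cb * Lb) (hS : S ^ 2 = Cs * L) (hL : L = La * Lb)
    (hCs : Cs ≠ 0) : Ka * Kb = (Ca * Cb / Cs) * S ^ 2 := by
  subst ha hb hL
  rw [hS, div_mul_eq_mul_div, eq_div_iff hCs]
  ring

/-- the constant of `Ka·Kb = w·S²` is unique once `S ≠ 0` (K10-safe: vanishing `L` is allowed,
vanishing `S` is exactly the excluded regime). -/
theorem constant_unique {Ka Kb S w w' : K} (h : Ka * Kb = w * S ^ 2) (h' : Ka * Kb = w' * S ^ 2)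
    (hS : S ≠ 0) : w = w' :=
  mul_right_cancel₀ (pow_ne_zero 2 hS) (h.symm.trans h')

theorem constant_ne_zero {Ca Cb Cs : K} (ha : Ca ≠ 0) (hb : Cb ≠ 0) (hs : Cs ≠ 0) :
    Ca * Cb / Cs ≠ 0 :=
  div_ne_zero (mul_ne_zero ha hb) hs

/-- (P-sq) Waldspurger gives the PAIR `P·P' = C·L`; with the conjugation/Atkin–Lehner passage
`P' = u·P` the square of ONE sum is `(C/u)·L` — `u` is a booked factor of the constant. -/
theorem sq_of_pair {P P' C L u : K} (h : P * P' = C * L) (hu : P' = u * P) (hu0 : u ≠ 0) :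
    P ^ 2 = (C / u) * L := by
  subst hu
  rw [div_mul_eq_mul_div, eq_div_iff hu0]
  linear_combination h

/-- (G2) valuation bookkeeping for the (G1) constant, over any map additive on non-zero products. -/
theorem ord_combine (ord : K → ℤ)
    (hmul : ∀ x y : K, x ≠ 0 → y ≠ 0 → ord (x * y) = ord x + ord y)
    (hinv : ∀ x : K, x ≠ 0 → ord x⁻¹ = -ord x)
    {Ca Cb Cs : K} (ha : Ca ≠ 0) (hb : Cb ≠ 0) (hs : Cs ≠ 0) :
    ord (Ca * Cb / Cs) = ord Ca + ord Cb - ord Cs := by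
  rw [div_eq_mul_inv, hmul _ _ (mul_ne_zero ha hb) (inv_ne_zero hs), hmul _ _ ha hb, hinv _ hs]
  ring

end Algebra

section Ledger

variable {Mem Key₂ Key₇ : Type*}

/-- the frame of the class: 2-adic key, 7-key, odd support and splitting signs of odd primes in `K₀`. -/
structure Frame (Mem Key₂ Key₇ : Type*) where
  key₂ : Mem → Key₂
  key₇ : Mem → Key₇
  oddSupport : Mem → Finset ℕ
  eps : ℕ → ℤ

/-- digits of LOCAL TYPE: a global constant, a LEVEL digit (archimedean, carries the level), the
2-adic digit (key × level), the 7-digit (key₇), and one digit per odd prime depending on `(q, ε(q))`. -/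
structure Digits (Key₂ Key₇ : Type*) where
  glob : ℤ
  lamInf : ℕ → ℤ
  lam₂ : Key₂ → ℕ → ℤ
  lam₇ : Key₇ → ℤ
  mu : ℕ → ℤ → ℤ

namespace Digits

/-- pointwise sum of digit records (the (G1) combination `Ca·Cb`). -/
def add (D E : Digits Key₂ Key₇) : Digits Key₂ Key₇ :=
  ⟨D.glob + E.glob, fun n => D.lamInf n + E.lamInf n, fun k n => D.lam₂ k n + E.lam₂ k n,
    fun k => D.lam₇ k + E.lam₇ k, fun q e => D.mu q e + E.mu q e⟩

/-- pointwise difference (the (G1) division by `Cs`). -/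
def sub (D E : Digits Key₂ Key₇) : Digits Key₂ Key₇ :=
  ⟨D.glob - E.glob, fun n => D.lamInf n - E.lamInf n, fun k n => D.lam₂ k n - E.lam₂ k n,
    fun k => D.lam₇ k - E.lam₇ k, fun q e => D.mu q e - E.mu q e⟩

end Digits

/-- the MEMBER digit: 7-digit plus the odd-prime digits (level-free by type). -/
def memberDigit (Φ : Frame Mem Key₂ Key₇) (D : Digits Key₂ Key₇) (d : Mem) : ℤ :=
  D.lam₇ (Φ.key₇ d) + ∑ q ∈ Φ.oddSupport d, D.mu q (Φ.eps q)

/-- `w` (a function of member and level) is of LOCAL TYPE with digits `D`. -/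
def IsOfLocalType (Φ : Frame Mem Key₂ Key₇) (w : Mem → ℕ → ℤ) (D : Digits Key₂ Key₇) : Prop :=
  ∀ d n, w d n = D.glob + D.lamInf n + D.lam₂ (Φ.key₂ d) n + memberDigit Φ D d

variable (Φ : Frame Mem Key₂ Key₇)

theorem memberDigit_add (D E : Digits Key₂ Key₇) (d : Mem) :
    memberDigit Φ (D.add E) d = memberDigit Φ D d + memberDigit Φ E d := by
  simp only [memberDigit, Digits.add, Finset.sum_add_distrib]
  ring

theorem memberDigit_sub (D E : Digits Key₂ Key₇) (d : Mem) :
    memberDigit Φ (D.sub E) d = memberDigit Φ D d - memberDigit Φ E d := by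
  simp only [memberDigit, Digits.sub, Finset.sum_sub_distrib]
  ring

/-- local type is closed under sums … -/
theorem IsOfLocalType.add {a b : Mem → ℕ → ℤ} {Da Db : Digits Key₂ Key₇}
    (ha : IsOfLocalType Φ a Da) (hb : IsOfLocalType Φ b Db) :
    IsOfLocalType Φ (fun d n => a d n + b d n) (Da.add Db) := by
  intro d n
  simp only [ha d n, hb d n, memberDigit_add]
  simp only [Digits.add]
  ring

/-- … and differences. -/
theorem IsOfLocalType.sub {a b : Mem → ℕ → ℤ} {Da Db : Digits Key₂ Key₇}
    (ha : IsOfLocalType Φ a Da) (hb : IsOfLocalType Φ b Db) :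
    IsOfLocalType Φ (fun d n => a d n - b d n) (Da.sub Db) := by
  intro d n
  simp only [ha d n, hb d n, memberDigit_sub]
  simp only [Digits.sub]
  ring

/-- (G2 at ledger level) `ord w = ord Ca + ord Cb − ord Cs` is of local type if the three are. -/
theorem localType_combine {a b s : Mem → ℕ → ℤ} {Da Db Ds : Digits Key₂ Key₇}
    (ha : IsOfLocalType Φ a Da) (hb : IsOfLocalType Φ b Db) (hs : IsOfLocalType Φ s Ds) :
    IsOfLocalType Φ (fun d n => a d n + b d n - s d n) ((Da.add Db).sub Ds) :=
  (ha.add Φ hb).sub Φ hs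

/-- (C1) REL at EVERY level (arm L): members with the same 2-adic key differ by their member digits. -/
theorem rel_of_localType {w : Mem → ℕ → ℤ} {D : Digits Key₂ Key₇} (h : IsOfLocalType Φ w D)
    {d d₀ : Mem} (hk : Φ.key₂ d = Φ.key₂ d₀) (n : ℕ) :
    w d n - w d₀ n = memberDigit Φ D d - memberDigit Φ D d₀ := by
  rw [h d n, h d₀ n, hk]
  ring

/-- (C3) δ-RIGIDITY (arm M): net of the member digits, `w` depends on the member only through `key₂`
(so it is invariant under any change of member preserving the key, e.g. `d ↦ 5d`). -/
theorem net_keyRigid_of_localType {w : Mem → ℕ → ℤ} {D : Digits Key₂ Key₇}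
    (h : IsOfLocalType Φ w D) {d d' : Mem} (hk : Φ.key₂ d = Φ.key₂ d') (n : ℕ) :
    w d n - memberDigit Φ D d = w d' n - memberDigit Φ D d' := by
  rw [h d n, h d' n, hk]
  ring

/-- (C4) NET class function: if the engine constant `w` and the Gross–Zagier constant `k` have the
SAME odd-prime digits (`D.mu = E.mu`: one toric functional at odd unramified places), then `w − k`
is a function of `(key₂, key₇, level)` alone — whatever the convention `κ`. -/
theorem classFunction_of_localType {w k : Mem → ℕ → ℤ} {D E : Digits Key₂ Key₇}
    (hw : IsOfLocalType Φ w D) (hk : IsOfLocalType Φ k E) (hmu : D.mu = E.mu) :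
    ∃ T : Key₂ → Key₇ → ℕ → ℤ, ∀ d n, w d n - k d n = T (Φ.key₂ d) (Φ.key₇ d) n := by
  refine ⟨fun a b n => D.glob + D.lamInf n + D.lam₂ a n + D.lam₇ b
      - (E.glob + E.lamInf n + E.lam₂ a n + E.lam₇ b), ?_⟩
  intro d n
  rw [hw d n, hk d n]
  simp only [memberDigit, hmu]
  ring

/-- (C5) B16 detector: if `w d ·` is constant from level `n₁` on, so is the sum of its level digits. -/
theorem levelDigits_eventually_const {w : Mem → ℕ → ℤ} {D : Digits Key₂ Key₇}
    (h : IsOfLocalType Φ w D) (d : Mem) (n₁ : ℕ) (hc : ∀ n, n₁ ≤ n → w d n = w d n₁) :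
    ∀ n, n₁ ≤ n →
      D.lamInf n + D.lam₂ (Φ.key₂ d) n = D.lamInf n₁ + D.lam₂ (Φ.key₂ d) n₁ := by
  intro n hn
  have h1 := hc n hn
  rw [h d n, h d n₁] at h1
  linarith

/-- NON-VACUITY (R66-testable): the digit of an odd prime `q` transfers between members — if two pairs
of equal-key members differ exactly by adjoining `q` to the odd support, the two differences agree. -/
theorem primeDigit_transfer {w : Mem → ℕ → ℤ} {D : Digits Key₂ Key₇} (h : IsOfLocalType Φ w D)
    {d₁ d₂ d₃ d₄ : Mem} {q : ℕ}
    (h12 : Φ.key₂ d₁ = Φ.key₂ d₂) (h34 : Φ.key₂ d₃ = Φ.key₂ d₄)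
    (h12' : Φ.key₇ d₁ = Φ.key₇ d₂) (h34' : Φ.key₇ d₃ = Φ.key₇ d₄)
    (hq₂ : q ∉ Φ.oddSupport d₂) (hq₄ : q ∉ Φ.oddSupport d₄)
    (hs₁ : Φ.oddSupport d₁ = insert q (Φ.oddSupport d₂))
    (hs₃ : Φ.oddSupport d₃ = insert q (Φ.oddSupport d₄)) (n : ℕ) :
    w d₁ n - w d₂ n = w d₃ n - w d₄ n := by
  rw [h d₁ n, h d₂ n, h d₃ n, h d₄ n]
  simp only [memberDigit, h12, h34, h12', h34', hs₁, hs₃, Finset.sum_insert hq₂,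
    Finset.sum_insert hq₄]
  ring

end Ledger

end Summit.BirchSwinnertonDyer.BirchSwinnertonDyer.Cruxes.SplitBadTwoLowerHalfOfFacts.StubPlanT3LocalType
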